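import Summits.MatrixMultiplication.OmegaCensus.SmallFormats.MatMul22nRankGF7Slack5Search
import HarnessLib

/-!
# ω-census family (a): replay of the slack-5 search certificate, CHECK A part 12 of 12 (elements `308 ≤ h < 336`)

Cell `pub-omega` (unit `pub-omega-tensor-g16`), topic `Summits/MatrixMultiplication/OmegaCensus` (sub-folder `SmallFormats`).
Framing (verbatim): lottery ticket; floor = certified bounds/negative ranges. HONEST FRAMING: machine-generated kernel replay
(`pub-omega-tensor-g16/code/gen5_runs.py`): `levelsOK5n h = true` for the elements `308 ≤ h < 336` of `PGL₂(7)`: for every slot `(c, h)`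
(`c < 656`) and bucket level, if the key of its column is visited then the bucket holds an entry with that column (SIMD key planes,
`MatMul22nRankGF7Plane`). Meaning: `slotOK5_of_levelsOK5` (`MatMul22nRankGF7Slack5SearchSound`). Nothing here is progress on `ω`.
-/

namespace Summit.MatrixMultiplication.OmegaCensus.SmallFormats

set_option Elab.async false

set_option maxRecDepth 100000 in
set_option maxHeartbeats 400000000 in
/-- Elements `308 ≤ h < 312`. -/
theorem levelsOK5_ok_308_312 : ∀ h : Fin 336, 308 ≤ h.val → h.val < 312 → levelsOK5n h.val = true := by decide +kernel

set_option maxRecDepth 100000 in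
set_option maxHeartbeats 400000000 in
/-- Elements `312 ≤ h < 316`. -/
theorem levelsOK5_ok_312_316 : ∀ h : Fin 336, 312 ≤ h.val → h.val < 316 → levelsOK5n h.val = true := by decide +kernel

set_option maxRecDepth 100000 in
set_option maxHeartbeats 400000000 in
/-- Elements `316 ≤ h < 320`. -/
theorem levelsOK5_ok_316_320 : ∀ h : Fin 336, 316 ≤ h.val → h.val < 320 → levelsOK5n h.val = true := by decide +kernel

set_option maxRecDepth 100000 in
set_option maxHeartbeats 400000000 in
/-- Elements `320 ≤ h < 324`. -/
theorem levelsOK5_ok_320_324 : ∀ h : Fin 336, 320 ≤ h.val → h.val < 324 → levelsOK5n h.val = true := by decide +kernel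

set_option maxRecDepth 100000 in
set_option maxHeartbeats 400000000 in
/-- Elements `324 ≤ h < 328`. -/
theorem levelsOK5_ok_324_328 : ∀ h : Fin 336, 324 ≤ h.val → h.val < 328 → levelsOK5n h.val = true := by decide +kernel

set_option maxRecDepth 100000 in
set_option maxHeartbeats 400000000 in
/-- Elements `328 ≤ h < 332`. -/
theorem levelsOK5_ok_328_332 : ∀ h : Fin 336, 328 ≤ h.val → h.val < 332 → levelsOK5n h.val = true := by decide +kernel

set_option maxRecDepth 100000 in
set_option maxHeartbeats 400000000 in
/-- Elements `332 ≤ h < 336`. -/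
theorem levelsOK5_ok_332_336 : ∀ h : Fin 336, 332 ≤ h.val → h.val < 336 → levelsOK5n h.val = true := by decide +kernel

/-- CHECK A for the elements `308 ≤ h < 336`. -/
theorem levelsOK5_run_12 : ∀ h : Fin 336, 308 ≤ h.val → h.val < 336 → levelsOK5n h.val = true := by
  intro h hlo hhi
  by_cases h312 : h.val < 312
  · exact levelsOK5_ok_308_312 h (by omega) h312
  by_cases h316 : h.val < 316
  · exact levelsOK5_ok_312_316 h (by omega) h316
  by_cases h320 : h.val < 320
  · exact levelsOK5_ok_316_320 h (by omega) h320
  by_cases h324 : h.val < 324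
  · exact levelsOK5_ok_320_324 h (by omega) h324
  by_cases h328 : h.val < 328
  · exact levelsOK5_ok_324_328 h (by omega) h328
  by_cases h332 : h.val < 332
  · exact levelsOK5_ok_328_332 h (by omega) h332
  exact levelsOK5_ok_332_336 h (by omega) hhi

end Summit.MatrixMultiplication.OmegaCensus.SmallFormats
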